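import Summits.QuantumFields.YangMills.Theorems.BalabanUVNodesPortS1G3CClose

/-!
# Crux `PortRecordRepresentationS1` (stmt-QuantumFields-27930), line `pta-residueW` (skeleton v3.5) — REGISTERED STUB `stub_G3C` LANDED: `∀ F, G3CAtRecordL F` (the located gap G-P6 over the
# repaired body — the resummed generalized random walk expansion of `Tr (x + T)⁻¹` at the record's complex localized carrier with unit-lattice decay, as the landed LETTER `G3CAtRecordL`), by
# hand-27930-G3C g1's ✓`…PortS1G3CClose.g3cAtRecordL_holds`

Cell `ym-nodeO-ideate`, porter seat `ymgap-nodeO-port-PTC-1` (gen 4) FILING ON DISPATCH (★★★ director-ym g22 №577, nodeO STATUS 2026-08-31T13:59:45Z: «the `stub_G3C` BY-NAME CLOSURE passes to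
▶ PTC-1 g4 — file it NOW (PTA-1 is between gens): ONE Theorems file whose theorem has EXACTLY the registered stub's statement `∀ F, …BalabanUVNodesPortS1.G3CAtRecordL F` (skeleton OF RECORD v3.5
`Cruxes/PortRecordRepresentationS1/Lines/pta_residueW.lean` :86) proved by `g3cAtRecordL_holds`, in the by-name form PTA-1 used for `stub_LZdetTwin`»; CLAIM posted 14:00:05Z); template =
▶ PTA-1 g8's ✓p823076 `…PortRecordRepresentationS1StubLZdetTwin.lean`; `--supports stmt-QuantumFields-27930` (stub credit: proves the registered stub BY NAME AND SIGNATURE).  AUTHORSHIP OF THE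
CONTENT: hand-27930-G3C g0∕g1 (✓p824928 `…PortS1G3CClose` and its cone ✓p823681 · ✓p823728 · ✓p823834 · ✓p823964 · ✓p824340 · ✓p824482 · ✓p824866 · ✓p824841); this file adds one line.
After this file the skeleton has TWO open stubs — `stub_P0C` (`P0HolExtAtRecordGL`, P0-class letter, node00-def-Y) and `stub_FE` (`PortRecordFEHalfBox`, XXL) — with `stub_LZjacDom`, `stub_LZjacKStep`,
`stub_LZdetTwin` and now `stub_G3C` CLOSED BY NAME and the glue `stub_LZdetGlue` a theorem outright.

HONEST FRAMING.  One registered stub proved BY NAME: `G3CAtRecordL F` is a CONDITIONAL letter (its antecedent is the displayed P0-ℂ body `P0CarrierClauses …` + the (P4-lat) lattice-decay inputs;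
its conclusion the `G3CPiecesAt` leaves) now inhabited for every `F` — its antecedent's supplier `stub_P0C` and the FE half `stub_FE` are OPEN, inhabited nowhere; NOTHING of Bałaban's renormalization-
group estimates beyond this letter is discharged; the crux ⟨27930⟩ ⁸-Ax-LR4 `PortRecordRepresentationS1` is OPEN · no claim; NODE O 0∕1; COUNT 8∕28 · K 1∕4 UNMOVED; finite `𝕋⁴_{L^K}` at fixed ε —
NOT continuum ∕ OS ∕ Clay; **the Yang–Mills mass gap is NOT proved by any of this.**  No `sorry`; standard axioms.
-/

namespace Summit.QuantumFields.YangMills.Theorems.BalabanUVNodesPortS1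

/-- ★★★ **REGISTERED STUB `stub_G3C` OF THE LINE `pta-residueW`**: the located-gap letter `G3CAtRecordL` (resummed generalized random walk expansion of `Tr (x + T)⁻¹` at the record's complex
localized carrier, unit-lattice decay) holds for every torus family — by hand-27930-G3C's ✓`g3cAtRecordL_holds`.  CONDITIONAL letter (antecedent = the displayed P0-ℂ body + (P4-lat)); nothing of
Bałaban's RG estimates beyond it discharged. [cite: Balaban1985UV3, (23)–(25) p.262, (63) p.272; Balaban1985BackgroundPropagators, (3.87)–(3.96) pp.409–411; Balaban1987RG1, (1.21) p.264] -/
theorem stub_G3C : ∀ F, Summit.QuantumFields.YangMills.Theorems.BalabanUVNodesPortS1.G3CAtRecordL F :=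
  fun F => g3cAtRecordL_holds F

end Summit.QuantumFields.YangMills.Theorems.BalabanUVNodesPortS1
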